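import Literature.Probability.Percolation.StraightCylinderCuts
import HarnessLib

/-!
# Pinned min-cuts through straight cylinders: a priori bound and quasi-monotonicity in the base

Topic `Literature/Probability/Percolation`; companion of `StraightCylinderCuts.lean` (pinned min-cuts
`pinnedCut a n h ω = τ(cyl, h)` of straight cylinders, Dembin 2020 §3 / Rossignol–Théret 2010 §2.1,
and the gluing theorem along a tiling of the base). Here:

* `pinnedCut_le_card` — the a priori bound `τ ≤ #(all lattice edges at the cylinder)` (closing
  every edge at the cylinder is a pinned cutset), whence integrability;
* `pinnedCut_le_pinnedCut_add` — **quasi-monotonicity in the base**: for `n ≤ n'` (same corner and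
  height) `τ(a, n, h) ≤ τ(a, n', h) + #(lattice edges at the inner walls of the small cylinder)`:
  an optimal cutset of the big cylinder together with all edges at the walls `xᵢ = aᵢ + n - 1` of the
  small one is a pinned cutset of the small one (an open lower-to-upper path of the small cylinder
  avoiding them never touches an inner wall, so its endpoints are pinned boundary vertices of the
  big cylinder as well). Pathwise monotonicity fails (the boundary condition is pinned on the
  walls); the defect is of lower order, `O(h n^{d-2})` edges.

The cardinality estimates of the seam and of the inner walls (`O(k^{d-1} n^{d-2})`, `O(h n^{d-2})`)
and the probabilistic assembly (flow constant at fixed height) follow in later files.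
-/

noncomputable section

namespace Literature.Probability.Percolation

open LatticeModels Literature.Combinatorics.SimpleGraph Finset

variable {d : ℕ} [NeZero d]

/-! ### Every vertex of a non-trivial walk lies on one of its edges -/

/-- A vertex of a walk of positive length lies on some edge of the walk. [folklore] -/
theorem exists_mem_edges_of_mem_support {V : Type*} {G : SimpleGraph V} :
    ∀ {u v : V} (p : G.Walk u v), 0 < p.length → ∀ z ∈ p.support, ∃ e ∈ p.edges, z ∈ e
  | _, _, SimpleGraph.Walk.nil, hl, _, _ => by simp at hl
  | u, _, SimpleGraph.Walk.cons (v := w) h p, _, z, hz => by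
    rw [SimpleGraph.Walk.support_cons, List.mem_cons] at hz
    rcases hz with rfl | hz
    · exact ⟨s(z, w), by simp, Sym2.mem_mk_left _ _⟩
    · by_cases hp : p.length = 0
      · have hw : z = w := by
          cases p with
          | nil => simpa using hz
          | cons _ _ => simp at hp
        subst hw
        exact ⟨s(u, z), by simp, Sym2.mem_mk_right _ _⟩
      · obtain ⟨e, he, hze⟩ := exists_mem_edges_of_mem_support p (Nat.pos_of_ne_zero hp) z hz
        exact ⟨e, by rw [SimpleGraph.Walk.edges_cons]; exact List.mem_cons_of_mem _ he, hze⟩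

/-! ### The a priori bound -/

/-- All lattice edges at the vertices of the cylinder. [folklore] -/
def cylEdges (a : Site d) (n h : ℕ) : Finset (Sym2 (Site d)) :=
  (scyl_finite a n h).toFinset.biUnion fun x => (zdGraph d).incidenceFinset x

/-- `#cylEdges ≤ 2d · #cylinder`. [folklore] -/
theorem card_cylEdges_le (a : Site d) (n h : ℕ) :
    (cylEdges a n h).card ≤ 2 * d * (scyl_finite a n h).toFinset.card := by
  calc (cylEdges a n h).card ≤ ∑ x ∈ (scyl_finite a n h).toFinset, ((zdGraph d).incidenceFinset x).card :=
        Finset.card_biUnion_le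
    _ = ∑ _x ∈ (scyl_finite a n h).toFinset, 2 * d := Finset.sum_congr rfl fun x _ => by
        rw [SimpleGraph.card_incidenceFinset_eq_degree, ← SimpleGraph.card_neighborFinset_eq_degree]
        convert card_neighborFinset_zdGraph_holds (d := d) x
    _ = 2 * d * (scyl_finite a n h).toFinset.card := by rw [Finset.sum_const, smul_eq_mul, mul_comm]

/-- **A priori bound**: closing all lattice edges at the cylinder is a pinned cutset, so
`τ(a, n, h) ≤ #cylEdges` (for lattice configurations). [folklore] -/
theorem pinnedCut_le_card (a : Site d) (n h : ℕ) {ω : BondConfig (Site d)}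
    (hω : ω ⊆ (zdGraph d).edgeSet) : pinnedCut a n h ω ≤ (cylEdges a n h).card := by
  classical
  refine minOpenCutIn_le_card ?_
  rw [isOpenCutsetIn_iff_isEdgeCutsetIn_openGraph]
  intro u v hu hv p
  have hlen : 0 < p.length := by
    refine Nat.pos_of_ne_zero fun h0 => ?_
    have huv := SimpleGraph.Walk.eq_of_length_eq_zero h0
    exact lowerBdry_disjoint_upperBdry a n h hu (by rw [huv]; exact hv)
  obtain ⟨e, he, hue⟩ := exists_mem_edges_of_mem_support p hlen u p.start_mem_support
  refine ⟨e, he, ?_⟩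
  revert he hue
  induction e using Sym2.ind with
  | h z z' =>
    intro he hue
    have hzz' : ((openGraph ω).induce (scyl a n h)).Adj z z' := p.adj_of_mem_edges he
    rw [SimpleGraph.induce_adj, openGraph_adj] at hzz'
    rw [Sym2.map_mk, Finset.mem_coe, cylEdges, Finset.mem_biUnion]
    refine ⟨z.1, by rw [Set.Finite.mem_toFinset]; exact z.2, ?_⟩
    rw [SimpleGraph.mem_incidenceFinset]
    exact ⟨hω hzz'.1, Sym2.mem_mk_left _ _⟩

/-! ### Inner walls and quasi-monotonicity in the base -/

open Classical in
/-- The **inner wall vertices** of the cylinder of side `n` inside the cylinder of a larger side with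
the same corner: `xᵢ = aᵢ + n - 1` for some base coordinate `i ≠ 0`. [folklore] -/
def innerWallVertices (a : Site d) (n h : ℕ) : Finset (Site d) :=
  (scyl_finite a n h).toFinset.filter fun x => ∃ i : Fin d, i ≠ 0 ∧ x i = a i + n - 1

/-- The lattice edges at the inner wall vertices. [folklore] -/
def innerWallEdges (a : Site d) (n h : ℕ) : Finset (Sym2 (Site d)) :=
  (innerWallVertices a n h).biUnion fun x => (zdGraph d).incidenceFinset x

/-- `#innerWallEdges ≤ 2d · #innerWallVertices`. [folklore] -/
theorem card_innerWallEdges_le (a : Site d) (n h : ℕ) :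
    (innerWallEdges a n h).card ≤ 2 * d * (innerWallVertices a n h).card := by
  calc (innerWallEdges a n h).card
      ≤ ∑ x ∈ innerWallVertices a n h, ((zdGraph d).incidenceFinset x).card := Finset.card_biUnion_le
    _ = ∑ _x ∈ innerWallVertices a n h, 2 * d := Finset.sum_congr rfl fun x _ => by
        rw [SimpleGraph.card_incidenceFinset_eq_degree, ← SimpleGraph.card_neighborFinset_eq_degree]
        convert card_neighborFinset_zdGraph_holds (d := d) x
    _ = 2 * d * (innerWallVertices a n h).card := by rw [Finset.sum_const, smul_eq_mul, mul_comm]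

/-- Cylinders with the same corner grow with the side. [folklore] -/
theorem scyl_mono (a : Site d) {n n' : ℕ} (hnn' : n ≤ n') (h : ℕ) : scyl a n h ⊆ scyl a n' h := by
  intro x hx
  refine ⟨hx.1, fun i hi => ⟨(hx.2 i hi).1, lt_of_lt_of_le (hx.2 i hi).2 ?_⟩⟩
  linarith [(show (n : ℤ) ≤ n' by exact_mod_cast hnn')]

/-- A lattice neighbour outside the small cylinder of a vertex of the small cylinder which is NOT an
inner wall vertex is outside the big cylinder as well. [folklore] -/
theorem not_mem_scyl_of_not_innerWall {a : Site d} {n n' h : ℕ} {x y : Site d}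
    (hx : x ∈ scyl a n h) (hwall : x ∉ innerWallVertices a n h) (hy : y ∉ scyl a n h)
    (hxy : (zdGraph d).Adj x y) : y ∉ scyl a n' h := by
  classical
  intro hy'
  obtain ⟨i, hi, hrest⟩ := exists_coord_of_adj hxy
  apply hy
  refine ⟨?_, fun i' hi' => ?_⟩
  · -- the height of `y` is fine unless the step is vertical, and then `|y 0| ≤ h` comes from `scyl a n' h`
    exact hy'.1
  · by_cases hii : i' = i
    · subst hii
      obtain ⟨h1, h2⟩ := hx.2 i' hi'
      obtain ⟨h1', h2'⟩ := hy'.2 i' hi'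
      rcases hi with hi | hi
      · refine ⟨by linarith, ?_⟩
        -- `y i' = x i' + 1 < a i' + n` unless `x i' = a i' + n - 1`, i.e. `x` is an inner wall vertex
        by_contra hge
        push Not at hge
        apply hwall
        rw [innerWallVertices, Finset.mem_filter, Set.Finite.mem_toFinset]
        exact ⟨hx, i', hi', by omega⟩
      · exact ⟨h1', by linarith⟩
    · rw [hrest i' hii]; exact hx.2 i' hi'

/-- **Quasi-monotonicity of the pinned min-cut in the base** (same corner and height, `n ≤ n'`):
`τ(a, n, h) ≤ τ(a, n', h) + #innerWallEdges(a, n, h)` for lattice configurations — an optimal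
cutset of the big cylinder plus all lattice edges at the inner walls of the small cylinder is a
pinned cutset of the small cylinder. [cite: Dembin2020, §3 (τ_p(A,h); cf. Rossignol–Théret 2010 §4.1)] -/
theorem pinnedCut_le_pinnedCut_add (a : Site d) {n n' : ℕ} (hnn' : n ≤ n') (h : ℕ)
    {ω : BondConfig (Site d)} (hω : ω ⊆ (zdGraph d).edgeSet) :
    pinnedCut a n h ω ≤ pinnedCut a n' h ω + (innerWallEdges a n h).card := by
  classical
  obtain ⟨E, hE, hcard⟩ := exists_eq_minOpenCutIn (pinnedCut_ne_top a n' h ω)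
  rw [pinnedCut, pinnedCut, ← hcard]
  set C : Finset (Sym2 (Site d)) := E ∪ innerWallEdges a n h with hC
  suffices hcut : IsOpenCutsetIn (scyl a n h) (lowerBdry a n h) (upperBdry a n h) ω ↑C by
    calc minOpenCutIn (scyl a n h) (lowerBdry a n h) (upperBdry a n h) ω ≤ (C.card : ℕ∞) :=
          minOpenCutIn_le_card hcut
      _ ≤ ((E.card + (innerWallEdges a n h).card : ℕ) : ℕ∞) := by exact_mod_cast Finset.card_union_le _ _
      _ = (E.card : ℕ∞) + (innerWallEdges a n h).card := by push_cast; rfl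
  rw [isOpenCutsetIn_iff_isEdgeCutsetIn_openGraph]
  intro u v hu hv p
  by_contra hcon
  push Not at hcon
  have hadjV : ∀ z z' : scyl a n h, ((openGraph ω).induce (scyl a n h)).Adj z z' →
      s(z.1, z'.1) ∈ ω ∧ (zdGraph d).Adj z.1 z'.1 := by
    intro z z' hzz'
    rw [SimpleGraph.induce_adj, openGraph_adj] at hzz'
    exact ⟨hzz'.1, hω hzz'.1⟩
  -- the walk has an edge, and none of its vertices is an inner wall vertex
  have hlen : 0 < p.length := by
    refine Nat.pos_of_ne_zero fun h0 => ?_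
    have huv := SimpleGraph.Walk.eq_of_length_eq_zero h0
    exact lowerBdry_disjoint_upperBdry a n h hu (by rw [huv]; exact hv)
  have hnowall : ∀ z ∈ p.support, (z : Site d) ∉ innerWallVertices a n h := by
    intro z hz hwall
    obtain ⟨e, he, hze⟩ := exists_mem_edges_of_mem_support p hlen z hz
    refine hcon e he ?_
    revert he hze
    induction e using Sym2.ind with
    | h w w' =>
      intro he hze
      have hww' := hadjV w w' (p.adj_of_mem_edges he)
      rw [Sym2.map_mk, Finset.mem_coe, hC, Finset.mem_union]
      right
      rw [innerWallEdges, Finset.mem_biUnion]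
      refine ⟨z.1, hwall, ?_⟩
      rw [SimpleGraph.mem_incidenceFinset]
      refine ⟨hww'.2, ?_⟩
      rcases Sym2.mem_iff.1 hze with rfl | rfl
      · exact Sym2.mem_mk_left _ _
      · exact Sym2.mem_mk_right _ _
  -- hence its endpoints are pinned boundary vertices of the big cylinder
  have hu' : (u : Site d) ∈ lowerBdry a n' h := by
    obtain ⟨huS, hu0, y, hy, huy⟩ := hu
    exact ⟨scyl_mono a hnn' h huS, hu0, y,
      not_mem_scyl_of_not_innerWall huS (hnowall u p.start_mem_support) hy huy, huy⟩
  have hv' : (v : Site d) ∈ upperBdry a n' h := by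
    obtain ⟨hvS, hv0, y, hy, hvy⟩ := hv
    exact ⟨scyl_mono a hnn' h hvS, hv0, y,
      not_mem_scyl_of_not_innerWall hvS (hnowall v p.end_mem_support) hy hvy, hvy⟩
  -- and the walk, viewed in the big cylinder, avoids `E`
  set p' := p.map (SimpleGraph.induceHomOfLE (openGraph ω) (scyl_mono a hnn' h)).toHom with hp'
  have hp'edges : ∀ e ∈ p'.edges, Sym2.map Subtype.val e ∉ (↑E : Set (Sym2 (Site d))) := by
    intro e he heE
    rw [hp', SimpleGraph.Walk.edges_map, List.mem_map] at he
    obtain ⟨e₀, he₀, rfl⟩ := he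
    refine hcon e₀ he₀ ?_
    rw [Finset.mem_coe, hC, Finset.mem_union]
    left
    revert heE
    induction e₀ using Sym2.ind with
    | h w w' => simp
  exact hE u hu' v hv' (mem_openConnIn_diff_of_walk p' hp'edges)

end Literature.Probability.Percolation
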